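import Summits.NavierStokesRegularity.FluidComputer.ClayBlowupCriteria
import Summits.NavierStokesRegularity.FluidComputer.ClayForcedLerayHopf
import Literature.Analysis.FluidPDE.TaoForcedNormalisedPressureDischarge
import Literature.Analysis.FluidPDE.NormalisedPressureLpClass
import Literature.Analysis.FluidPDE.ClassicalSuitable
import Literature.Analysis.FluidPDE.SuitableWeakCongr
import Literature.Analysis.FluidPDE.SuitableWeakExhaustion
import Literature.Analysis.FluidPDE.SereginSverakPressureProofs
import HarnessLib

/-!
# The normalised pressure of a Clay blow-up: Tao's pressure IS `-Δ⁻¹∂ᵢ∂ⱼ(uᵢuⱼ) + Δ⁻¹∇·f`, and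
# `(u, -Δ⁻¹∂ᵢ∂ⱼ(uᵢuⱼ) + Δ⁻¹∇·f)` is a suitable weak solution on the open lifespan slab

Cell `ns-blowup`, seat `ns-blowup-ecbridge-2` (g6; the E–C endpoint theory seat). LABEL: E–C typing
(KERNEL — no named fact). WHAT THIS IS NOT: not Navier–Stokes evidence — regularity bookkeeping about
the TYPE `ClayBlowup ν` (`ClayBlowup.lean`; no inhabitant is claimed anywhere). Companion memo:
`run/shared/lean/pub/ns-blowup/ecbridge2/ECBRIDGE-2-MEMO-5.md`.

## Why

MEMO-4 §3/§4 (i) left ONE gap between the two E–C types: `ClayBlowup ν → DesignedBlowup ν`, i.e.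
«the singularity of a Clay blow-up cannot escape to spatial infinity». The tree PROVES
Lemarié-Rieusset's ε-regularity criterion WITH FORCE (Thm. 14.4, `lemarieRieusset_epsilon_regularity_holds`)
for suitable weak solutions in the sense of Caffarelli–Kohn–Nirenberg; to feed it one needs, on the
open lifespan slab `(0, T) × ℝ³`, a pressure that is (a) a suitable-weak pressure for `(u, f)` and
(b) controlled in `L^{3/2}` THROUGH `T`. The structure's own pressure `X.p` is neither in general (it
is `p_N + c(t)` with an arbitrary gauge `c`). This file supplies the canonical choice, Tao's normalised
pressure (9) `p_N(t, x) = normalisedPressure (u t) x + forcePotential (f t) x`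
(`= -Δ⁻¹∂ᵢ∂ⱼ(uᵢuⱼ) + Δ⁻¹∇·f`):

* `ClayBlowup.taoPressure_ae_eq_normalisedPressure` — on a closed sub-slab `[0, T']`, `T' < T`, ANY
  classical pressure `p'` of `u` whose slices are square integrable (e.g. the Tao-class pressure of
  `ClayBlowup.exists_taoPressure`) equals `p_N` for a.e. `t` (Tao 2013, Lemma 4.1 (i) WITH force —
  the tree theorem `tao2011_forced_pressure_normalisation_ae_holds` — plus `L²` rigidity of
  constants: `p'(t), p̃[u(t)], Δ⁻¹∇·f(t) ∈ L²(ℝ³)`, `const_eq_zero_of_lintegral_sq_lt_top`);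
* `ClayBlowup.isSuitableWeakSolutionOn_normalisedPressure_subslab` — `(u, p_N)` is a suitable weak
  solution WITH FORCE `f` (Caffarelli–Kohn–Nirenberg (2.1)–(2.5), the tree's
  `IsSuitableWeakSolutionOn`) on every open sub-slab `(0, T') × ℝ³`, `T' < T` (classical `(u, p')` is
  suitable, `isSuitableWeakSolutionOn_of_contDiffOn`; a.e. modification of the pressure,
  `IsSuitableWeakSolutionOn.congr_ae`);
* **`ClayBlowup.isSuitableWeakSolutionOn_normalisedPressure`** — hence on the whole open lifespan
  slab `(0, T) × ℝ³` (`IsSuitableWeakSolutionOn.of_exhaustion` along `T - T/(n+2) ↑ T`).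

The slab integrability of `|u|³`, `|p̃[u]|^{3/2}`, `|Δ⁻¹∇·f|²` through `T` and the far-field bound
are the companion file `ClayBlowupFarField.lean`.

References: T. Tao, Anal. PDE 6 (2013) = arXiv:1108.1165, Lemma 4.1 (i), (9) [cite: Tao2011, Lemma 4.1 (i)];
L. Caffarelli, R. Kohn, L. Nirenberg, CPAM 35 (1982) §2 (2.1)–(2.5) [cite: CaffarelliKohnNirenberg1982, §2];
E. M. Stein, *Singular integrals* (1970), Ch. II §4.2 Thm 3 [cite: Stein1971, Ch. II §4.2 Thm. 3];
C. L. Fefferman, Clay problem description, (C) [cite: FeffermanClay2006, (C)].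
-/

noncomputable section

namespace Summit.NavierStokesRegularity.FluidComputer

open Set MeasureTheory Filter Topology Function TopologicalSpace Metric
open scoped ENNReal ContDiff NNReal
open Literature.Analysis.FluidPDE
open Summit.NavierStokesRegularity.NavierStokesRegularity
open Summit.NavierStokesRegularity.FluidComputer.PalasekTowerClayBridge
open Summit.NavierStokesRegularity.FluidComputer.ClayForcedLerayHopf

/-! ## §1 Two `L²` helpers -/

/-- `‖g‖_{L²} < ∞` gives `∫⁻ ‖g‖ₑ² < ∞`. [folklore] -/
theorem lintegral_enorm_sq_lt_top_of_memLp {G : Type*} [NormedAddCommGroup G]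
    {g : EuclideanSpace ℝ (Fin 3) → G} (hg : MemLp g 2 volume) : ∫⁻ x, ‖g x‖ₑ ^ 2 < ⊤ := by
  have h := lintegral_rpow_enorm_lt_top_of_eLpNorm_lt_top two_ne_zero ENNReal.ofNat_ne_top
    hg.eLpNorm_lt_top
  simpa [ENNReal.rpow_two] using h

/-- `∫⁻ ‖g‖ₑ² < ∞` and measurability give `g ∈ L²`. [folklore] -/
theorem memLp_two_of_lintegral_enorm_sq_lt_top {G : Type*} [NormedAddCommGroup G]
    {g : EuclideanSpace ℝ (Fin 3) → G} (hgm : AEStronglyMeasurable g volume)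
    (h : ∫⁻ x, ‖g x‖ₑ ^ 2 < ⊤) : MemLp g 2 volume := by
  refine ⟨hgm, ?_⟩
  rw [eLpNorm_lt_top_iff_lintegral_rpow_enorm_lt_top two_ne_zero ENNReal.ofNat_ne_top]
  simpa [ENNReal.rpow_two] using h

/-- **A bounded slice with `∫‖v‖² < ∞` is in `L⁴`** (`∫‖v‖⁴ ≤ B² ∫‖v‖²`). [folklore] -/
theorem memLp_four_of_bound_of_lintegral_sq
    {v : EuclideanSpace ℝ (Fin 3) → EuclideanSpace ℝ (Fin 3)} (hv : Continuous v) {B : ℝ}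
    (hB : ∀ x, ‖v x‖ ≤ B) (hv2 : ∫⁻ x, ‖v x‖ₑ ^ 2 < ⊤) : MemLp v 4 volume := by
  refine ⟨hv.aestronglyMeasurable, ?_⟩
  have h4 : ∫⁻ x, ‖v x‖ₑ ^ 4 < ⊤ := by
    have hpt : ∀ x, ‖v x‖ₑ ^ 4 ≤ ENNReal.ofReal (B ^ 2) * ‖v x‖ₑ ^ 2 := by
      intro x
      have h1 : ‖v x‖ₑ ^ 2 ≤ ENNReal.ofReal (B ^ 2) := by
        rw [← ofReal_norm, ← ENNReal.ofReal_pow (norm_nonneg _)]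
        exact ENNReal.ofReal_le_ofReal (pow_le_pow_left₀ (norm_nonneg _) (hB x) 2)
      calc ‖v x‖ₑ ^ 4 = ‖v x‖ₑ ^ 2 * ‖v x‖ₑ ^ 2 := by ring
        _ ≤ ENNReal.ofReal (B ^ 2) * ‖v x‖ₑ ^ 2 := mul_le_mul_left h1 _
    calc ∫⁻ x, ‖v x‖ₑ ^ 4 ≤ ∫⁻ x, ENNReal.ofReal (B ^ 2) * ‖v x‖ₑ ^ 2 := lintegral_mono hpt
      _ = ENNReal.ofReal (B ^ 2) * ∫⁻ x, ‖v x‖ₑ ^ 2 := lintegral_const_mul' _ _ ENNReal.ofReal_ne_top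
      _ < ⊤ := ENNReal.mul_lt_top ENNReal.ofReal_lt_top hv2
  rw [eLpNorm_lt_top_iff_lintegral_rpow_enorm_lt_top (by norm_num) (by norm_num)]
  have h4r : (4 : ℝ≥0∞).toReal = ((4 : ℕ) : ℝ) := by norm_num
  simp_rw [h4r, ENNReal.rpow_natCast]
  exact h4

namespace ClayBlowup

variable {ν : ℝ} (X : ClayBlowup ν)

/-! ## §2 Tao's pressure is the normalised pressure -/

/-- **ANY square-integrable classical pressure of a Clay blow-up on a closed sub-slab is the
NORMALISED pressure `-Δ⁻¹∂ᵢ∂ⱼ(uᵢuⱼ) + Δ⁻¹∇·f`, a.e. in time.** For `ν > 0`, `0 < T' < T` and a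
pressure `p'` with `(u, p')` classical on `[0, T'] × ℝ³` and `sup_{t ≤ T'} ∫|p'(t)|² < ∞` (Tao's class,
`ClayBlowup.exists_taoPressure`): for a.e. `t ∈ [0, T']`,
`p'(t, x) = normalisedPressure (u t) x + forcePotential (f t) x` for all `x`. Proof: Tao 2013,
Lemma 4.1 (i) WITH force (tree theorem `tao2011_forced_pressure_normalisation_ae_holds`) gives the
identity up to `C(t)`; `p'(t) ∈ L²` by hypothesis, `p̃[u(t)] ∈ L²` by Stein's bound (`u(t) ∈ L² ∩ L^∞`),
`Δ⁻¹∇·f(t) ∈ L²` for a Clay force (`clayForce_forcePotential_bounds`); a constant in `L²(ℝ³)` is `0`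
(`const_eq_zero_of_lintegral_sq_lt_top`). No named fact. [cite: Tao2011, Lemma 4.1 (i)] -/
theorem taoPressure_ae_eq_normalisedPressure (hν : 0 < ν) {T' : ℝ} (hT'0 : 0 < T') (hT' : T' < X.T)
    {p' : ℝ → EuclideanSpace ℝ (Fin 3) → ℝ} (hsol : IsClassicalNSSolutionOn (Icc 0 T') ν X.f X.u p')
    (hp0 : ∃ C : ℝ≥0, ∀ t ∈ Icc 0 T', ∫⁻ x, ‖iteratedFDeriv ℝ 0 (p' t) x‖ₑ ^ 2 ≤ C) :
    ∀ᵐ t ∂(volume.restrict (Icc 0 T')), ∀ x,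
      p' t x = normalisedPressure (X.u t) x + forcePotential (X.f t) x := by
  -- Lemma 4.1 (i) with force on `[0, T']`
  have hfs : IsSmoothSpaceTimeOn (Icc 0 T') X.f := X.force_smooth.isSmoothSpaceTimeOn_Icc T'
  obtain ⟨F, hFt, hF⟩ := ClayEvolution.clayForce_lintegral_sqrt_energy_le X.force_decay
  have hfE : ∫⁻ t in Icc 0 T', (∫⁻ x, ‖X.f t x‖ₑ ^ 2) ^ (1 / 2 : ℝ) < ⊤ := (hF T').trans_lt hFt
  obtain ⟨A, hAt, hA⟩ := X.energy T' hT'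
  have hE : ∃ A : ℝ≥0, ∀ t ∈ Icc 0 T', ∫⁻ x, ‖X.u t x‖ₑ ^ 2 ≤ A :=
    ⟨A.toNNReal, fun t ht => (hA t ht).trans (ENNReal.coe_toNNReal hAt.ne).ge⟩
  obtain ⟨C, -, hae⟩ := tao2011_forced_pressure_normalisation_ae_holds hν hT'0 hsol hfs hfE hE
  -- uniform bounds on `[0, T']`
  obtain ⟨B, hB⟩ := X.exists_norm_le hν hT'
  obtain ⟨Pf, hPft, hPf⟩ := clayForce_forcePotential_bounds X.force_smooth X.force_decay
  obtain ⟨P₀, hP₀⟩ := hp0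
  filter_upwards [hae, ae_restrict_mem measurableSet_Icc] with t ht htI
  have htT : t ∈ Ico 0 X.T := ⟨htI.1, htI.2.trans_lt hT'⟩
  -- `u(t) ∈ L⁴`, hence `p̃[u(t)] ∈ L²`
  have hu2 : ∫⁻ x, ‖X.u t x‖ₑ ^ 2 < ⊤ := (hA t htI).trans_lt hAt
  have hu4 : MemLp (X.u t) 4 volume :=
    memLp_four_of_bound_of_lintegral_sq (X.classical.contDiff_velocity htT).continuous (hB t htI)
      hu2
  have hu4' : MemLp (X.u t) (2 * 2) volume := by
    rw [show (2 : ℝ≥0∞) * 2 = 4 by norm_num]; exact hu4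
  have hϖ : MemLp (normalisedPressure (X.u t)) 2 volume :=
    memLp_normalisedPressure_of_memLp_two_mul (p := 2) (by norm_num) (by simp) hu4'
  -- `Δ⁻¹∇·f(t) ∈ L²`
  obtain ⟨hpfm, hpf2⟩ := hPf t htI.1
  have hpf : MemLp (forcePotential (X.f t)) 2 volume :=
    memLp_two_of_lintegral_enorm_sq_lt_top hpfm (hpf2.trans_lt hPft)
  -- the normalised pressure slice is in `L²`
  have hsum : ∫⁻ x, ‖normalisedPressure (X.u t) x + forcePotential (X.f t) x‖ₑ ^ 2 < ⊤ :=
    lintegral_enorm_sq_lt_top_of_memLp (hϖ.add hpf)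
  -- `p'(t) ∈ L²`, continuous
  have hpc : Continuous (p' t) := (hsol.contDiff_pressure htI).continuous
  have hp2 : ∫⁻ x, ‖p' t x‖ₑ ^ 2 < ⊤ := by
    refine lt_of_le_of_lt (le_of_eq (lintegral_congr fun x => ?_)) ((hP₀ t htI).trans_lt
      ENNReal.coe_lt_top)
    rw [← ofReal_norm, ← ofReal_norm, norm_iteratedFDeriv_zero]
  -- the constant is in `L²(ℝ³)`, hence zero
  have hc : ∀ x, p' t x - (normalisedPressure (X.u t) x + forcePotential (X.f t) x) = C t :=
    fun x => by rw [ht x]; ring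
  have hC0 : C t = 0 := const_eq_zero_of_lintegral_sq_lt_top hpc hp2 hsum hc
  intro x
  rw [ht x, hC0, add_zero]

/-! ## §3 `(u, p_N)` is a suitable weak solution with force `f` on the open lifespan slab -/

/-- **On every open sub-slab `(0, T') × ℝ³`, `T' < T`, `(u, -Δ⁻¹∂ᵢ∂ⱼ(uᵢuⱼ) + Δ⁻¹∇·f)` is a suitable
weak solution WITH FORCE `f`** in the sense of Caffarelli–Kohn–Nirenberg (2.1)–(2.5) (the tree's
`IsSuitableWeakSolutionOn`; `ν > 0`): the classical pair `(u, p')` with Tao's pressure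
(`exists_taoPressure`) is one (`isSuitableWeakSolutionOn_of_contDiffOn`: for smooth solutions (2.5)
holds with equality, whatever happens at the top of the slab), and `p' = p_N` a.e. on the slab
(`taoPressure_ae_eq_normalisedPressure`, `IsSuitableWeakSolutionOn.congr_ae`). No named fact.
[cite: CaffarelliKohnNirenberg1982, §2] [cite: Tao2011, Lemma 4.1 (i)] -/
theorem isSuitableWeakSolutionOn_normalisedPressure_subslab (hν : 0 < ν) {T' : ℝ} (hT'0 : 0 < T')
    (hT' : T' < X.T) :
    IsSuitableWeakSolutionOn (slab (EuclideanSpace ℝ (Fin 3)) (Ioo 0 T') isOpen_Ioo) ν X.f X.u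
      (fun t x => normalisedPressure (X.u t) x + forcePotential (X.f t) x) := by
  obtain ⟨p', hsol, -, hpS⟩ := X.exists_taoPressure hν hT'0 hT'
  -- the classical pair on the open interval is a suitable weak solution
  have hcl : IsClassicalNSSolutionOn (Ioo 0 T') ν X.f X.u p' :=
    hsol.mono Ioo_subset_Icc_self isOpen_Ioo.uniqueDiffOn
  have hsub : ((slab (EuclideanSpace ℝ (Fin 3)) (Ioo 0 T') isOpen_Ioo :
      Opens (ℝ × EuclideanSpace ℝ (Fin 3))) : Set (ℝ × EuclideanSpace ℝ (Fin 3))) ⊆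
        Ioo 0 T' ×ˢ univ := (coe_slab _ _).subset
  have hfc : ContinuousOn (uncurry X.f) (Ioo 0 T' ×ˢ (univ : Set (EuclideanSpace ℝ (Fin 3)))) :=
    X.force_smooth.continuousOn.mono (prod_mono (fun t ht => (le_of_lt ht.1 : (0 : ℝ) ≤ t))
      Subset.rfl)
  have hsw : IsSuitableWeakSolutionOn (slab (EuclideanSpace ℝ (Fin 3)) (Ioo 0 T') isOpen_Ioo)
      ν X.f X.u p' := by
    refine isSuitableWeakSolutionOn_of_contDiffOn isOpen_Ioo hsub
      (hcl.smooth_velocity.of_le (by norm_cast)) (hcl.smooth_pressure.of_le (by norm_cast)) hfc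
      (fun t ht x => ?_) hcl.divFree
    have e : timeDerivWithin (Ioo 0 T') X.u t x = timeDeriv X.u t x := by
      simp only [timeDerivWithin, timeDeriv]
      exact derivWithin_of_isOpen isOpen_Ioo ht
    rw [← e]
    exact hcl.momentum t ht x
  -- `p' = p_N` a.e. on the slab
  have hae := X.taoPressure_ae_eq_normalisedPressure hν hT'0 hT' hsol (hpS 0)
  have h1 := ae_restrict_prod_univ_of_ae_restrict measurableSet_Icc hae
  have h2 : ∀ᵐ z ∂((volume : Measure (ℝ × EuclideanSpace ℝ (Fin 3))).restrict
      (Ioo 0 T' ×ˢ (univ : Set (EuclideanSpace ℝ (Fin 3))))),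
      ∀ x, p' z.1 x = normalisedPressure (X.u z.1) x + forcePotential (X.f z.1) x :=
    ae_restrict_of_ae_restrict_of_subset (prod_mono Ioo_subset_Icc_self Subset.rfl) h1
  refine hsw.congr_ae (ae_of_all _ fun _ => rfl) ?_
  rw [coe_slab]
  filter_upwards [h2] with z hz
  exact hz z.2

/-- **`(u, -Δ⁻¹∂ᵢ∂ⱼ(uᵢuⱼ) + Δ⁻¹∇·f)` is a suitable weak solution WITH FORCE `f` on the whole open
lifespan slab `(0, T) × ℝ³` of a Clay blow-up** (`ν > 0`): suitability is local (Caffarelli–Kohn–Nirenberg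
§2), and the sub-slabs `(0, T - T/(n+2)) × ℝ³` exhaust the open slab
(`IsSuitableWeakSolutionOn.of_exhaustion`). This is the standing hypothesis of the forced ε-regularity
criterion (Lemarié-Rieusset 2016, Thm. 14.4) on every box compactly inside the lifespan. No named fact.
[cite: CaffarelliKohnNirenberg1982, §2] -/
theorem isSuitableWeakSolutionOn_normalisedPressure (hν : 0 < ν) :
    IsSuitableWeakSolutionOn (slab (EuclideanSpace ℝ (Fin 3)) (Ioo 0 X.T) isOpen_Ioo) ν X.f X.u
      (fun t x => normalisedPressure (X.u t) x + forcePotential (X.f t) x) := by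
  have hT := X.T_pos
  -- the exhaustion `Tₙ = T - T/(n+2) ↑ T`
  set Tn : ℕ → ℝ := fun n => X.T - X.T / (n + 2) with hTn
  have hTn_pos : ∀ n, 0 < Tn n := fun n => by
    have h2 : (2 : ℝ) ≤ (n : ℝ) + 2 := by
      have := (Nat.cast_nonneg n : (0 : ℝ) ≤ (n : ℝ)); linarith
    have : X.T / (n + 2) ≤ X.T / 2 := div_le_div_of_nonneg_left hT.le (by norm_num) h2
    simp only [hTn]; linarith
  have hTn_lt : ∀ n, Tn n < X.T := fun n => by
    simp only [hTn]
    have : 0 < X.T / (n + 2) := div_pos hT (by positivity)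
    linarith
  have hTn_mono : Monotone Tn := fun m n hmn => by
    simp only [hTn]
    have : X.T / (n + 2) ≤ X.T / (m + 2) :=
      div_le_div_of_nonneg_left hT.le (by positivity) (by exact_mod_cast Nat.add_le_add_right hmn 2)
    linarith
  refine IsSuitableWeakSolutionOn.of_exhaustion
    (Qn := fun n => slab (EuclideanSpace ℝ (Fin 3)) (Ioo 0 (Tn n)) isOpen_Ioo)
    (fun n => slab_mono (Ioo_subset_Ioo_right (hTn_lt n).le))
    (fun m n hmn => slab_mono (Ioo_subset_Ioo_right (hTn_mono hmn)))
    (fun K hK hKc => ?_)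
    (fun n => X.isSuitableWeakSolutionOn_normalisedPressure_subslab hν (hTn_pos n) (hTn_lt n))
  -- a compact subset of the open slab stays below some `Tₙ`
  have hK' : K ⊆ Ioo 0 X.T ×ˢ (univ : Set (EuclideanSpace ℝ (Fin 3))) := by
    rw [← coe_slab (X := EuclideanSpace ℝ (Fin 3)) (Ioo 0 X.T) isOpen_Ioo]; exact hK
  obtain ⟨T'', hT'', hKsub⟩ := exists_subset_Icc_prod_of_isCompact hKc hK' hT
  obtain ⟨n, hn⟩ := exists_nat_gt (X.T / (X.T - T''))
  have hTt : 0 < X.T - T'' := sub_pos.2 hT''.2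
  have hlt : T'' < Tn n := by
    simp only [hTn]
    have hn2 : X.T / (X.T - T'') < (n : ℝ) + 2 := by linarith
    have : X.T / ((n : ℝ) + 2) < X.T - T'' := by
      rw [div_lt_iff₀ (by positivity)]
      have h1 : X.T = X.T / (X.T - T'') * (X.T - T'') := by field_simp
      have h2 : X.T / (X.T - T'') * (X.T - T'') < ((n : ℝ) + 2) * (X.T - T'') :=
        mul_lt_mul_of_pos_right hn2 hTt
      linarith [mul_comm ((n : ℝ) + 2) (X.T - T'')]
    linarith
  refine ⟨n, fun z hz => ?_⟩
  change z ∈ (slab (EuclideanSpace ℝ (Fin 3)) (Ioo 0 (Tn n)) isOpen_Ioo :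
    Set (ℝ × EuclideanSpace ℝ (Fin 3)))
  rw [coe_slab]
  exact ⟨⟨(hK' hz).1.1, (hKsub hz).1.2.trans_lt hlt⟩, mem_univ _⟩

end ClayBlowup

end Summit.NavierStokesRegularity.FluidComputer

end
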